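import Summits.KontsevichZagierPeriods.KontsevichZagierPeriods.Theorems.SoloBlindBeta
import Literature.NumberTheory.Transcendental.KZSemiCanonicalReductionProofs
import HarnessLib

/-!
# Legendre's duplication formula inside the rules

`B(a,a) = 2^{1-2a} B(a,½)` (Legendre 1809) for rational `a > 0`, realised as an identity of
Beta classes in `Q = FormalRep ⧸ relations` by THREE moves of Kontsevich–Zagier (2001, §1.2):

1. domain additivity `(0,1) = (0,½) ∪ (½,1)` up to the null point `½`
   (`betaRep_sub_halves`);
2. the symmetry `t ↦ 1 - t` carrying the right half onto the left half (`rightHalf_sub_leftHalf`);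
3. the ALGEBRAIC change of variables `s = 4t(1-t)` of `(0,½)` onto `(0,1)` (`leftHalf_sub_target`),
   under which `t^{a-1}(1-t)^{a-1} dt = 4^{-a} s^{a-1}(1-s)^{-1/2} ds` because
   `1 - 4t(1-t) = (1-2t)²`.

Result: `betaQ_dupl : β(a,a) = duplCoeff a • β(a,½)` with `duplCoeff a = 2·4^{-a} ∈ K₀`
(`coe_duplCoeff`), e.g. `duplCoeff ¼ = √2` (`coe_duplCoeff_quarter`): `β(¼,¼) = √2 • β(¼,½)`,
which puts Gauss's constant / the Fermat quartic into the lemniscate sector, and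
`β(⅓,⅓) = 2^{1/3} • β(⅓,½)`, which puts the real period of `y² = 1 - x³` into the equianharmonic
sector (`SoloBlindEllipticRegions`).

References: M. Kontsevich, D. Zagier, *Periods* (2001), §1.2; A. M. Legendre, *Exercices de calcul
intégral* I (1811); G. Andrews, R. Askey, R. Roy, *Special Functions* (1999), Thm 1.5.1.
-/

noncomputable section

namespace Summit.KontsevichZagierPeriods.KontsevichZagierPeriods.Theorems

open Set MeasureTheory MvPolynomial
open Literature.ModelTheory.ExponentialFields (IsSemialgebraic)
open Literature.NumberTheory.Transcendental
open Literature.NumberTheory.Transcendental.KZ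
open Literature.Analysis.SpecialFunctions.Selberg

namespace SoloBlind

/-! ## Algebraic constants `4^a` -/

/-- `4^a` is real algebraic for rational `a` (it is a root of `X^{den a} - 4^{num a}`). -/
theorem isAlgebraic_four_rpow (a : ℚ) : IsAlgebraic ℚ ((4:ℝ) ^ (a : ℝ)) := by
  refine IsAlgebraic.of_pow a.den_pos ?_
  rw [← Real.rpow_natCast, ← Real.rpow_mul (by norm_num : (0:ℝ) ≤ 4),
    show (a : ℝ) * (a.den : ℕ) = ((a.num : ℤ) : ℝ) by exact_mod_cast a.mul_den_eq_num,
    Real.rpow_intCast]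
  simpa using isAlgebraic_rat ℚ (A := ℝ) ((4:ℚ) ^ a.num)

/-- The duplication coefficient `2·4^{-a} = 2^{1-2a}`, as an element of `K₀ = ℚ̄ ∩ ℝ`. -/
def duplCoeff (a : ℚ) : K₀ :=
  2 * ⟨(4:ℝ) ^ ((-a : ℚ) : ℝ), mem_K₀_iff.mpr (isAlgebraic_four_rpow (-a))⟩

/-- `(duplCoeff a : ℝ) = 2 · 4^{-a}`. -/
theorem coe_duplCoeff (a : ℚ) : ((duplCoeff a : K₀) : ℝ) = 2 * (4:ℝ) ^ (-(a : ℝ)) := by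
  have h2 : ((2 : K₀) : ℝ) = 2 := rfl
  rw [duplCoeff, MulMemClass.coe_mul, h2]
  push_cast
  rfl

/-- `duplCoeff a ≠ 0`. -/
theorem duplCoeff_ne_zero (a : ℚ) : duplCoeff a ≠ 0 := by
  intro h
  have h' := congrArg (fun z : K₀ => (z : ℝ)) h
  simp only [coe_duplCoeff, ZeroMemClass.coe_zero] at h'
  have : (0:ℝ) < 2 * (4:ℝ) ^ (-(a : ℝ)) := by positivity
  linarith

/-- `duplCoeff ¼ = √2`. -/
theorem coe_duplCoeff_quarter : ((duplCoeff (1 / 4) : K₀) : ℝ) = Real.sqrt 2 := by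
  rw [coe_duplCoeff, show (4:ℝ) = 2 ^ (2:ℝ) by norm_num, ← Real.rpow_mul (by norm_num)]
  push_cast
  norm_num
  rw [Real.sqrt_eq_rpow, show -((1:ℝ) / 2) = (1:ℝ) / 2 - 1 by norm_num,
    Real.rpow_sub (by norm_num : (0:ℝ) < 2), Real.rpow_one]
  field_simp

/-- `duplCoeff ⅓ = 2^{1/3}`. -/
theorem coe_duplCoeff_third : ((duplCoeff (1 / 3) : K₀) : ℝ) = (2:ℝ) ^ ((1:ℝ) / 3) := by
  rw [coe_duplCoeff, show (4:ℝ) = 2 ^ (2:ℝ) by norm_num, ← Real.rpow_mul (by norm_num)]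
  push_cast
  rw [show (2:ℝ) * -(1 / 3) = (1:ℝ) / 3 - 1 by norm_num,
    Real.rpow_sub (by norm_num : (0:ℝ) < 2), Real.rpow_one]
  field_simp

/-! ## The two halves of `β(a,a)` -/

section halves

/-- The symmetric Beta integrand `t^{a-1}(1-t)^{a-1}`. -/
def symmIntegrand (a : ℚ) (t : ℝ) : ℝ := t ^ ((a : ℝ) - 1) * (1 - t) ^ ((a : ℝ) - 1)

/-- `t^{a-1}(1-t)^{a-1}` is `ℚ`-semialgebraic on any subinterval `(p,q) ⊆ (0,1)` with algebraic
ends. -/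
theorem isSemialgebraicFunOn_symmIntegrand (a : ℚ) {p q : ℝ} (hp : IsAlgebraic ℚ p)
    (hq : IsAlgebraic ℚ q) (h0 : 0 ≤ p) (h1 : q ≤ 1) :
    IsSemialgebraicFunOn ℚ (line (Ioo p q)) (fun x : Fin 1 → ℝ => symmIntegrand a (x 0)) := by
  refine ((isSemialgebraicFunOn_const_mul_rpow_mul_rpow 1 (a - 1) (a - 1)).congr
    fun x _ => ?_).mono (fun x hx => ?_) (isSemialgebraic_line_Ioo hp hq)
  · simp only [symmIntegrand]
    push_cast
    ring
  · have hx : x 0 ∈ Ioo p q := hx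
    exact ⟨h0.trans_lt hx.1, hx.2.trans_le h1⟩

/-- `t^{a-1}(1-t)^{a-1}` is integrable on any subinterval of `(0,1)`. -/
theorem integrableOn_symmIntegrand (a : ℚ) (ha : 0 < a) {p q : ℝ} (h0 : 0 ≤ p) (h1 : q ≤ 1) :
    IntegrableOn (symmIntegrand a) (Ioo p q) :=
  ((integrableOn_Ioo_rpow_mul_one_sub_rpow_and_integral_eq (Rat.cast_pos.mpr ha)
    (Rat.cast_pos.mpr ha)).1.mono_set (Ioo_subset_Ioo h0 h1)).congr_fun (fun _ _ => rfl)
    measurableSet_Ioo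

/-- The left half `[(0,½), t^{a-1}(1-t)^{a-1}]`. -/
def leftHalf (a : ℚ) (ha : 0 < a) : IntegralRep 1 :=
  lineRep (Ioo 0 (1 / 2)) (symmIntegrand a)
    (isSemialgebraic_line_Ioo isAlgebraic_zero
      (by simpa using isAlgebraic_rat ℚ (A := ℝ) (1 / 2)))
    (isSemialgebraicFunOn_symmIntegrand a isAlgebraic_zero
      (by simpa using isAlgebraic_rat ℚ (A := ℝ) (1 / 2)) le_rfl (by norm_num))
    (integrableOn_symmIntegrand a ha le_rfl (by norm_num))

/-- The right half `[(½,1), t^{a-1}(1-t)^{a-1}]`. -/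
def rightHalf (a : ℚ) (ha : 0 < a) : IntegralRep 1 :=
  lineRep (Ioo (1 / 2) 1) (symmIntegrand a)
    (isSemialgebraic_line_Ioo
      (by simpa using isAlgebraic_rat ℚ (A := ℝ) (1 / 2)) isAlgebraic_one)
    (isSemialgebraicFunOn_symmIntegrand a
      (by simpa using isAlgebraic_rat ℚ (A := ℝ) (1 / 2)) isAlgebraic_one (by norm_num) le_rfl)
    (integrableOn_symmIntegrand a ha (by norm_num) le_rfl)

/-- **Move (domain additivity): `β(a,a) ≡ leftHalf + rightHalf`** (the point `½` is null). -/
theorem betaRep_sub_halves (a : ℚ) (ha : 0 < a) :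
    of (betaRep a a ha ha) - (of (leftHalf a ha) + of (rightHalf a ha)) ∈ relations := by
  suffices h : of (betaRep a a ha ha) - ∑ i ∈ (Finset.univ : Finset (Fin 2)),
      of (![leftHalf a ha, rightHalf a ha] i) ∈ relations by
    rw [Fin.sum_univ_two, Matrix.cons_val_zero, Matrix.cons_val_one,
      Matrix.cons_val_fin_one] at h
    exact h
  refine of_sub_sum_of_mem_relations (Finset.univ : Finset (Fin 2)) (betaRep a a ha ha)
    ![leftHalf a ha, rightHalf a ha] ?_ ?_ ?_ ?_
  · intro i _
    fin_cases i
    · refine measure_mono_null (fun x hx => ?_) measure_empty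
      have h1 : x 0 ∈ Ioo (0:ℝ) (1 / 2) := hx.1
      exact hx.2 (show x 0 ∈ Ioo (0:ℝ) 1 from ⟨h1.1, h1.2.trans (by norm_num)⟩)
    · refine measure_mono_null (fun x hx => ?_) measure_empty
      have h1 : x 0 ∈ Ioo ((1:ℝ) / 2) 1 := hx.1
      exact hx.2 (show x 0 ∈ Ioo (0:ℝ) 1 from ⟨(by norm_num : (0:ℝ) < 1 / 2).trans h1.1, h1.2⟩)
  · intro i _
    fin_cases i <;> exact fun _ _ => rfl
  · have hnull : volume {x : Fin 1 → ℝ | x 0 = 1 / 2} = 0 := by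
      rw [volume_pi]
      exact Measure.pi_hyperplane (fun _ : Fin 1 => (volume : Measure ℝ)) 0 (1 / 2)
    refine measure_mono_null (fun x hx => ?_) hnull
    have h0 : x 0 ∈ Ioo (0:ℝ) 1 := hx.1
    have hn := hx.2
    simp only [Finset.mem_univ, iUnion_true, mem_iUnion, not_exists] at hn
    by_contra hc
    rcases lt_or_gt_of_ne hc with hlt | hgt
    · exact hn 0 (show x 0 ∈ Ioo (0:ℝ) (1 / 2) from ⟨h0.1, hlt⟩)
    · exact hn 1 (show x 0 ∈ Ioo ((1:ℝ) / 2) 1 from ⟨hgt, h0.2⟩)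
  · intro i _ j _ hij
    refine measure_mono_null (fun x hx => ?_) measure_empty
    fin_cases i <;> fin_cases j
    · exact (hij rfl).elim
    · have h1 : x 0 ∈ Ioo (0:ℝ) (1 / 2) := hx.1
      have h2 : x 0 ∈ Ioo ((1:ℝ) / 2) 1 := hx.2
      exact (lt_irrefl _ (h1.2.trans h2.1)).elim
    · have h1 : x 0 ∈ Ioo ((1:ℝ) / 2) 1 := hx.1
      have h2 : x 0 ∈ Ioo (0:ℝ) (1 / 2) := hx.2
      exact (lt_irrefl _ (h2.2.trans h1.1)).elim
    · exact (hij rfl).elim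

/-- **Move (symmetry `t ↦ 1 - t`): `rightHalf ≡ leftHalf`.** -/
theorem rightHalf_sub_leftHalf (a : ℚ) (ha : 0 < a) :
    of (rightHalf a ha) - of (leftHalf a ha) ∈ relations := by
  unfold rightHalf leftHalf
  refine lineRep_subst (fun t => 1 - t) (fun _ => -1)
    ((isSemialgebraicFunOn_aeval (isSemialgebraic_line_Ioo
        (by simpa using isAlgebraic_rat ℚ (A := ℝ) (1 / 2)) isAlgebraic_one)
      (1 - X 0 : MvPolynomial (Fin 1) ℚ)).congr fun x _ => by simp)
    (fun t _ => by simpa using ((hasDerivAt_id t).const_sub 1).hasDerivWithinAt)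
    (fun x _ y _ h => by simpa using h) ?_ (fun t _ => ?_)
  · ext s
    simp only [mem_Ioo, mem_image]
    constructor
    · rintro ⟨h0, h1⟩
      exact ⟨1 - s, ⟨by linarith, by linarith⟩, by ring⟩
    · rintro ⟨t, ⟨h0, h1⟩, rfl⟩
      exact ⟨by linarith, by linarith⟩
  · simp only [symmIntegrand, sub_sub_cancel, abs_neg, abs_one, mul_one]
    ring

end halves

/-! ## The algebraic change of variables `s = 4t(1-t)` -/

section target

/-- The target `[(0,1), 4^{-a} s^{a-1}(1-s)^{-1/2}] = 4^{-a} · β(a,½)` as a representation on the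
line. -/
def duplTarget (a : ℚ) (ha : 0 < a) : IntegralRep 1 :=
  (betaRep a (1 / 2) ha (by norm_num)).constMul ((4:ℝ) ^ ((-a : ℚ) : ℝ))
    (isAlgebraic_four_rpow (-a))

/-- `duplTarget` spelled out as a `lineRep`. -/
theorem duplTarget_eq (a : ℚ) (ha : 0 < a) : duplTarget a ha =
    lineRep (Ioo 0 1) (fun s => (4:ℝ) ^ ((-a : ℚ) : ℝ) *
      (s ^ ((a : ℝ) - 1) * (1 - s) ^ ((((1:ℚ) / 2 : ℚ) : ℝ) - 1)))
      (isSemialgebraic_line_Ioo isAlgebraic_zero isAlgebraic_one)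
      (IsSemialgebraicFunOn.mul_holds (isSemialgebraicFunOn_const_of_isAlgebraic
        (isSemialgebraic_line_Ioo isAlgebraic_zero isAlgebraic_one) (isAlgebraic_four_rpow (-a)))
        (betaRep a (1 / 2) ha (by norm_num)).isSemialgebraicFunOn_integrand)
      (((integrableOn_Ioo_rpow_mul_one_sub_rpow_and_integral_eq (Rat.cast_pos.mpr ha)
        (by norm_num : (0:ℝ) < (((1:ℚ) / 2 : ℚ) : ℝ))).1).const_mul _) :=
  IntegralRep.ext' rfl rfl

/-- `x ↦ 4x(1-x)` is injective on `(0,½)`. -/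
theorem injOn_dupl : InjOn (fun t : ℝ => 4 * (t * (1 - t))) (Ioo 0 (1 / 2)) := by
  intro x hx y hy h
  have h' : (x - y) * (1 - x - y) = 0 := by
    have h := h
    simp only at h
    linear_combination h / 4
  rcases mul_eq_zero.mp h' with h1 | h1
  · linarith
  · linarith [hx.2, hy.2]

/-- `x ↦ 4x(1-x)` maps `(0,½)` onto `(0,1)`. -/
theorem image_dupl : Ioo (0:ℝ) 1 = (fun t : ℝ => 4 * (t * (1 - t))) '' Ioo 0 (1 / 2) := by
  ext s
  simp only [mem_Ioo, mem_image]
  constructor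
  · rintro ⟨h0, h1⟩
    have hw : 0 < Real.sqrt (1 - s) := Real.sqrt_pos.mpr (by linarith)
    have hw1 : Real.sqrt (1 - s) < 1 := by
      rw [Real.sqrt_lt' one_pos]
      linarith
    refine ⟨(1 - Real.sqrt (1 - s)) / 2, ⟨by linarith, by linarith⟩, ?_⟩
    have hsq : Real.sqrt (1 - s) ^ 2 = 1 - s := Real.sq_sqrt (by linarith)
    nlinarith [hsq]
  · rintro ⟨t, ⟨h0, h1⟩, rfl⟩
    exact ⟨by nlinarith, by nlinarith⟩

/-- `(1 - 4t(1-t))^{1/2 - 1} = (1-2t)⁻¹` for `t < ½`. -/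
theorem one_sub_dupl_rpow {t : ℝ} (ht : t < 1 / 2) :
    (1 - 4 * (t * (1 - t))) ^ ((((1:ℚ) / 2 : ℚ) : ℝ) - 1) = (1 - 2 * t)⁻¹ := by
  have hw : 0 < 1 - 2 * t := by linarith
  rw [show 1 - 4 * (t * (1 - t)) = (1 - 2 * t) ^ 2 by ring, ← Real.rpow_natCast,
    ← Real.rpow_mul hw.le, ← Real.rpow_neg_one]
  push_cast
  norm_num

/-- `(4t(1-t))^{a-1} = 4^{a-1} t^{a-1} (1-t)^{a-1}` on `(0,1)`. -/
theorem dupl_rpow {t : ℝ} (h0 : 0 < t) (h1 : t < 1) (e : ℝ) :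
    (4 * (t * (1 - t))) ^ e = (4:ℝ) ^ e * (t ^ e * (1 - t) ^ e) := by
  rw [Real.mul_rpow (by norm_num) (mul_nonneg h0.le (by linarith)),
    Real.mul_rpow h0.le (by linarith)]

/-- The pull-back identity: `t^{a-1}(1-t)^{a-1} = 4^{-a}(4t(1-t))^{a-1}(1-4t(1-t))^{-1/2}·|4(1-2t)|`
on `(0,½)`. -/
theorem dupl_pullback (a : ℚ) {t : ℝ} (ht : t ∈ Ioo (0:ℝ) (1 / 2)) :
    symmIntegrand a t = (4:ℝ) ^ ((-a : ℚ) : ℝ) *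
      ((4 * (t * (1 - t))) ^ ((a : ℝ) - 1) * (1 - 4 * (t * (1 - t))) ^ ((((1:ℚ) / 2 : ℚ) : ℝ) - 1))
      * |4 * (1 * (1 - t) + t * -1)| := by
  have h0 := ht.1
  have hw : 0 < 1 - 2 * t := by linarith [ht.2]
  rw [one_sub_dupl_rpow ht.2, dupl_rpow h0 (by linarith [ht.2]),
    show 4 * (1 * (1 - t) + t * -1) = 4 * (1 - 2 * t) by ring, abs_of_pos (by positivity),
    symmIntegrand]
  have h4 : (4:ℝ) ^ ((-a : ℚ) : ℝ) * (4:ℝ) ^ ((a : ℝ) - 1) = 4⁻¹ := by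
    rw [← Real.rpow_add (by norm_num : (0:ℝ) < 4),
      show ((-a : ℚ) : ℝ) + ((a : ℝ) - 1) = -1 by push_cast; ring, Real.rpow_neg_one]
  calc t ^ ((a : ℝ) - 1) * (1 - t) ^ ((a : ℝ) - 1)
      = ((4:ℝ) ^ ((-a : ℚ) : ℝ) * (4:ℝ) ^ ((a : ℝ) - 1)) * 4 *
          (t ^ ((a : ℝ) - 1) * (1 - t) ^ ((a : ℝ) - 1)) * ((1 - 2 * t)⁻¹ * (1 - 2 * t)) := by
        rw [h4, inv_mul_cancel₀ hw.ne']
        ring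
    _ = _ := by ring

/-- **Move (change of variables `s = 4t(1-t)`): `leftHalf ≡ 4^{-a} · β(a,½)`.** -/
theorem leftHalf_sub_target (a : ℚ) (ha : 0 < a) :
    of (leftHalf a ha) - of (duplTarget a ha) ∈ relations := by
  rw [duplTarget_eq]
  unfold leftHalf
  refine lineRep_subst (fun t => 4 * (t * (1 - t))) (fun t => 4 * (1 * (1 - t) + t * -1))
    ((isSemialgebraicFunOn_aeval (isSemialgebraic_line_Ioo isAlgebraic_zero
        (by simpa using isAlgebraic_rat ℚ (A := ℝ) (1 / 2)))
      (4 * (X 0 * (1 - X 0)) : MvPolynomial (Fin 1) ℚ)).congr fun x _ => by simp)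
    (fun t _ => (((hasDerivAt_id t).mul ((hasDerivAt_id t).const_sub 1)).const_mul 4
      ).hasDerivWithinAt) injOn_dupl image_dupl (fun t ht => dupl_pullback a ht)

/-! ## Duplication in `Q` -/

/-- **Legendre's duplication formula inside the rules: `β(a,a) = (2·4^{-a}) • β(a,½)`.** -/
theorem betaQ_dupl (a : ℚ) (ha : 0 < a) : betaQ a a = duplCoeff a • betaQ a (1 / 2) := by
  have h1 : mkQ (of (betaRep a a ha ha)) =
      mkQ (of (leftHalf a ha)) + mkQ (of (rightHalf a ha)) := by
    rw [← map_add, mkQ_eq_mkQ_iff]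
    exact betaRep_sub_halves a ha
  have h2 : mkQ (of (rightHalf a ha)) = mkQ (of (leftHalf a ha)) :=
    mkQ_eq_mkQ_iff.mpr (rightHalf_sub_leftHalf a ha)
  have h3 : mkQ (of (leftHalf a ha)) =
      (⟨(4:ℝ) ^ ((-a : ℚ) : ℝ), mem_K₀_iff.mpr (isAlgebraic_four_rpow (-a))⟩ : K₀) •
        betaQ a (1 / 2) := by
    rw [betaQ_eq ha (by norm_num), ← mkQ_constMul, mkQ_eq_mkQ_iff]
    exact leftHalf_sub_target a ha
  rw [betaQ_eq ha ha, h1, h2, h3, duplCoeff, mul_smul, two_smul]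

end target

/-- `β(¼,¼) = √2 • β(¼,½)` (`coe_duplCoeff_quarter`). -/
theorem betaQ_dupl_quarter :
    betaQ (1 / 4) (1 / 4) = duplCoeff (1 / 4) • betaQ (1 / 4) (1 / 2) :=
  betaQ_dupl (1 / 4) (by norm_num)

/-- `β(⅓,⅓) = 2^{1/3} • β(⅓,½)` (`coe_duplCoeff_third`). -/
theorem betaQ_dupl_third :
    betaQ (1 / 3) (1 / 3) = duplCoeff (1 / 3) • betaQ (1 / 3) (1 / 2) :=
  betaQ_dupl (1 / 3) (by norm_num)

/-- Period check: `B(a,a) = 2·4^{-a}·B(a,½)` for rational `a > 0`, read off in `ℝ`. -/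
theorem beta_dupl_value (a : ℚ) (ha : 0 < a) :
    evalQ (betaQ a a) = 2 * (4:ℝ) ^ (-(a : ℝ)) * evalQ (betaQ a (1 / 2)) := by
  rw [betaQ_dupl a ha, evalQ_smul, coe_duplCoeff]

end SoloBlind

end Summit.KontsevichZagierPeriods.KontsevichZagierPeriods.Theorems
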